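import Summits.AtomisticToContinuum.FouriersLaw.Theorems.BondHeatUncertaintySubdiffusiveBondHeatJunctionProfileBudget

/-!
# The half-Ohmic rung in RESPONSE currency: `SqrtResponse ↔ HalfOhmicFloor`

Support file for stmt-AtomisticToContinuum-11071 (`BondHeatUncertainty.BoundedResponse`; residual of record 11071 ∧ 9121),
decomposition cell `decomp-a2c`, lens-1 (grading), gen 57 — file (7a) of the lineage EscapeGrading → JunctionKernel → (2) → (3) → (4) → (5) (imports ONLY (5)
`…JunctionProfileBudget`, p842352).

The exponent ladder `ExponentFloor s` is stated in ESCAPE currency (`E_N(T) ≤ C/N^s`); the blocker has both currencies in the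
tree (`OhmicFloor ↔ BoundedResponse`).  Corrector-side arguments (Green–Kubo in corrector form, route `OddSectorIrreversibility`)
produce bounds on RESPONSE coefficients `D_N` along arbitrary steady-state families, so the rung they can feed is the response twin
of `HalfOhmicFloor = ExponentFloor (1/2)`:

* `SqrtResponse` — **`R(1/2)`**: along every steady-state family, for every `T > 0` and every sequence of response coefficients
  `D_N` (the `δ → 0` limits of `J_N(T+δ/2, T-δ/2)/δ`), `∃ S, ∀ N ≥ 2, D_N ≤ S·√N` (one-sided, eventual; same binders as 11071).
* `sqrtResponse_iff_halfOhmicFloor` — **`R(1/2) ⟺ F(1/2)`** by the PROVED response identity `D_N = (N-1)γE_N`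
  (`boundaryEscapeDeficit_responseIdentity_holds`), weak-NESS uniqueness (`bondHeatUncertainty_nessUnique_holds`) and steady-state
  existence (`pinnedChain_exists_isSteadyState`), exactly as `boundedResponse_iff_ohmicFloor` one rung up; the real-arithmetic kernels
  are `escapeFloor_half_of_response_le_sqrt` / `response_le_sqrt_of_escapeFloor_half`.
* corollaries: `sqrtResponse_of_boundedResponse` (11071 ⟹ R(1/2)), `boundedResponse_of_splitLaw_of_sqrtResponse`
  (`SplitLaw θ`, `θ < 1/2`, + R(1/2) ⟹ 11071), `boundedResponse_of_sqrtResponse_of_bootstrap`, and the NODE instances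
  `boundedResponse_of_bufferedJunctionLaw_of_sqrtResponse` / `boundedResponse_of_localityPassivityLaw_of_sqrtResponse`
  (**11071 ⟸ LocalityPassivityLaw ∧ R(1/2)**: the constant-defect law of file (5) + the half-Ohmic rung in response currency).

File (7b) `…HalfOhmicOfConeScaleCorrector.lean` proves `ConeScaleCorrector → SqrtResponse` (crux E1, stmt-14069), i.e. the rung is FED.
Tags: `SqrtResponse` UNDECIDED (⟺ F(1/2); implied by 11071; implies `NonBallistic`-type statements).  Nothing here closes an item.
References: folklore.
-/

noncomputable section

open MeasureTheory Filter Topology Set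
open scoped BigOperators

namespace Summit.AtomisticToContinuum.FouriersLaw.Theorems.SubdiffusiveBondHeat

namespace EscapeGrading

open Literature.MathematicalPhysics.KineticTheory.HeatConduction
open Summit.AtomisticToContinuum.FouriersLaw.Theses.BondHeatUncertainty (BoundedResponse)

/-- **`R(1/2)`, the half-Ohmic rung in response currency:** along every steady-state family of the pinned anharmonic chain, for every
`T > 0` and every sequence `D` of response coefficients at `T`, `∃ S, ∀ N ≥ 2, D_N ≤ S·√N`.  Same binders as `BoundedResponse`
(11071), conclusion weakened from `sup_N |D_N| < ∞` to `D_N = O(√N)`.  UNDECIDED; ⟺ `HalfOhmicFloor` (`sqrtResponse_iff_halfOhmicFloor`);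
fed by crux E1 `ConeScaleCorrector` (file 7b). [piece · rung] -/
def SqrtResponse : Prop :=
  ∀ ω₂ lam β γ : ℝ, 0 < ω₂ → 0 < lam → 0 < β → 0 < γ →
    ∀ μ : (N : ℕ) → ℝ → ℝ → Measure (PhaseSpace N),
      (∀ (N : ℕ) (T_L T_R : ℝ), 0 < T_L → 0 < T_R →
        (pinnedChain ω₂ lam β γ).IsSteadyState N T_L T_R (μ N T_L T_R)) →
      ∀ T : ℝ, 0 < T → ∀ D : ℕ → ℝ,
        (∀ N : ℕ, Tendsto (fun δ : ℝ => (pinnedChain ω₂ lam β γ).totalCurrent (μ N (T + δ / 2) (T - δ / 2)) / δ)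
          (𝓝[≠] 0) (𝓝 (D N))) →
        ∃ S : ℝ, ∀ N : ℕ, 2 ≤ N → D N ≤ S * Real.sqrt N

/-! ## Abstract real arithmetic -/

/-- `D_N ≤ S√N` (`N ≥ 2`) and `D_N = (N−1)γE_N` (`N ≥ 1`) give `E_N ≤ (2·max S 0/γ)/√N` for `N ≥ 2` (`√N·√N = N ≤ 2(N−1)`). [folklore] -/
theorem escapeFloor_half_of_response_le_sqrt {E D : ℕ → ℝ} {γ S : ℝ} (hγ : 0 < γ)
    (hD : ∀ N : ℕ, 0 < N → D N = ((N : ℝ) - 1) * γ * E N) (hS : ∀ N : ℕ, 2 ≤ N → D N ≤ S * Real.sqrt N) :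
    ∀ N : ℕ, 2 ≤ N → E N ≤ 2 * max S 0 / γ / Real.sqrt N := by
  intro N hN
  have hNr : (2 : ℝ) ≤ N := by exact_mod_cast hN
  have hn0 : (0 : ℝ) < N := by linarith
  have hsq : 0 < Real.sqrt (N : ℝ) := Real.sqrt_pos.2 hn0
  have hsqn : Real.sqrt (N : ℝ) * Real.sqrt (N : ℝ) = N := Real.mul_self_sqrt hn0.le
  have hM0 : 0 ≤ max S 0 := le_max_right _ _
  have hkey : ((N : ℝ) - 1) * γ * E N ≤ max S 0 * Real.sqrt N := by
    rw [← hD N (by omega)]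
    exact (hS N hN).trans (mul_le_mul_of_nonneg_right (le_max_left _ _) hsq.le)
  rw [le_div_iff₀ hsq, le_div_iff₀ hγ]
  -- `(N-1) γ E √N ≤ max S 0 · N ≤ 2 max S 0 (N-1)`
  have h1 : ((N : ℝ) - 1) * γ * E N * Real.sqrt N ≤ max S 0 * N := by
    calc ((N : ℝ) - 1) * γ * E N * Real.sqrt N ≤ max S 0 * Real.sqrt N * Real.sqrt N :=
          mul_le_mul_of_nonneg_right hkey hsq.le
      _ = max S 0 * N := by rw [mul_assoc, hsqn]
  have h2 : max S 0 * (N : ℝ) ≤ 2 * max S 0 * ((N : ℝ) - 1) := by nlinarith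
  have h3 : ((N : ℝ) - 1) * (γ * E N * Real.sqrt N) ≤ ((N : ℝ) - 1) * (2 * max S 0) := by nlinarith
  have h4 : γ * E N * Real.sqrt N ≤ 2 * max S 0 := le_of_mul_le_mul_left h3 (by linarith)
  linarith

/-- Conversely, `D_N = (N−1)γE_N` (`N ≥ 1`) and `E_N ≤ C/√N` (`N ≥ N₀`) give `D_N ≤ S√N` for all `N ≥ 2`, with
`S = γ·max C 0 + ∑_{k<N₀} |D_k|` (eventually `(N-1)/√N ≤ √N`; the finitely many earlier `N` by `√N ≥ 1`). [folklore] -/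
theorem response_le_sqrt_of_escapeFloor_half {E D : ℕ → ℝ} {γ C : ℝ} {N₀ : ℕ} (hγ : 0 < γ)
    (hD : ∀ N : ℕ, 0 < N → D N = ((N : ℝ) - 1) * γ * E N)
    (hfl : ∀ N : ℕ, N₀ ≤ N → E N ≤ C / Real.sqrt N) :
    ∃ S : ℝ, ∀ N : ℕ, 2 ≤ N → D N ≤ S * Real.sqrt N := by
  refine ⟨γ * max C 0 + ∑ k ∈ Finset.range N₀, |D k|, fun N hN => ?_⟩
  have hNr : (2 : ℝ) ≤ N := by exact_mod_cast hN
  have hn0 : (0 : ℝ) < N := by linarith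
  have hsq : 0 < Real.sqrt (N : ℝ) := Real.sqrt_pos.2 hn0
  have hsqn : Real.sqrt (N : ℝ) * Real.sqrt (N : ℝ) = N := Real.mul_self_sqrt hn0.le
  have hsq1 : 1 ≤ Real.sqrt (N : ℝ) := Real.one_le_sqrt.2 (by linarith)
  have hM0 : 0 ≤ max C 0 := le_max_right _ _
  have hsum0 : 0 ≤ ∑ k ∈ Finset.range N₀, |D k| := Finset.sum_nonneg fun k _ => abs_nonneg _
  rcases le_or_gt N₀ N with hN₀ | hN₀
  · -- eventual regime
    have hDN : D N = ((N : ℝ) - 1) * γ * E N := hD N (by omega)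
    have hE : E N ≤ max C 0 / Real.sqrt N :=
      (hfl N hN₀).trans (div_le_div_of_nonneg_right (le_max_left _ _) hsq.le)
    have h1 : D N ≤ ((N : ℝ) - 1) * γ * (max C 0 / Real.sqrt N) := by
      rw [hDN]
      exact mul_le_mul_of_nonneg_left hE (by nlinarith)
    have h2 : ((N : ℝ) - 1) * γ * (max C 0 / Real.sqrt N) ≤ γ * max C 0 * Real.sqrt N := by
      rw [mul_div_assoc', div_le_iff₀ hsq]
      have : ((N : ℝ) - 1) ≤ Real.sqrt N * Real.sqrt N := by rw [hsqn]; linarith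
      have hγM : 0 ≤ γ * max C 0 := by positivity
      nlinarith
    calc D N ≤ γ * max C 0 * Real.sqrt N := h1.trans h2
      _ ≤ (γ * max C 0 + ∑ k ∈ Finset.range N₀, |D k|) * Real.sqrt N := by nlinarith
  · -- the finitely many `N < N₀`
    have h1 : D N ≤ ∑ k ∈ Finset.range N₀, |D k| :=
      (le_abs_self _).trans (Finset.single_le_sum (f := fun k => |D k|) (fun k _ => abs_nonneg _)
        (Finset.mem_range.2 hN₀))
    have h2 : ∑ k ∈ Finset.range N₀, |D k| ≤ (γ * max C 0 + ∑ k ∈ Finset.range N₀, |D k|) * 1 := by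
      nlinarith
    calc D N ≤ (γ * max C 0 + ∑ k ∈ Finset.range N₀, |D k|) * 1 := h1.trans h2
      _ ≤ (γ * max C 0 + ∑ k ∈ Finset.range N₀, |D k|) * Real.sqrt N :=
          mul_le_mul_of_nonneg_left hsq1 (by positivity)

/-! ## `R(1/2) ⟺ F(1/2)` -/

/-- **`SqrtResponse ⟹ HalfOhmicFloor`.**  Along the canonical steady-state family (existence + choice), the proved response identity makes
`D_N := (N−1)γE_N` a sequence of response coefficients (`D_0 = 0` by `totalCurrent_zero`); `R(1/2)` bounds it by `S√N`, whence
`E_N ≤ (2·max S 0/γ)/√N` for `N ≥ 2`. [folklore] -/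
theorem halfOhmicFloor_of_sqrtResponse : SqrtResponse → HalfOhmicFloor := by
  intro hR ω₂ lam β γ hω hl hβ hγ T hT
  classical
  have huniq := bondHeatUncertainty_nessUnique_holds ω₂ lam β γ hω hl hβ hγ
  -- the canonical steady-state family
  let μ₀ : (N : ℕ) → ℝ → ℝ → MeasureTheory.Measure (PhaseSpace N) := fun N T_L T_R =>
    if h : 0 < T_L ∧ 0 < T_R then
      Classical.choose (pinnedChain_exists_isSteadyState hω hl hβ hγ N h.1 h.2) else 0
  have hμ₀ : ∀ (N : ℕ) (T_L T_R : ℝ), 0 < T_L → 0 < T_R →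
      (pinnedChain ω₂ lam β γ).IsSteadyState N T_L T_R (μ₀ N T_L T_R) := by
    intro N T_L T_R hL' hR'
    simp only [μ₀, dif_pos (And.intro hL' hR')]
    exact Classical.choose_spec (pinnedChain_exists_isSteadyState hω hl hβ hγ N hL' hR')
  have hRI := boundaryEscapeDeficit_responseIdentity_holds ω₂ lam β γ hω hl hβ hγ huniq μ₀ hμ₀ T hT
  dsimp only at hRI
  let D : ℕ → ℝ := fun N => if N = 0 then 0 else ((N : ℝ) - 1) * γ * escapeDeficit ω₂ lam β γ T N
  have hDpos : ∀ N : ℕ, 0 < N → D N = ((N : ℝ) - 1) * γ * escapeDeficit ω₂ lam β γ T N := fun N hN => by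
    simp [D, hN.ne']
  have hD : ∀ N : ℕ, Tendsto
      (fun δ : ℝ => (pinnedChain ω₂ lam β γ).totalCurrent (μ₀ N (T + δ / 2) (T - δ / 2)) / δ)
      (𝓝[≠] 0) (𝓝 (D N)) := by
    intro N
    rcases Nat.eq_zero_or_pos N with rfl | hN
    · have hD0 : D 0 = 0 := by simp [D]
      rw [hD0]
      simp only [OscillatorChain.totalCurrent_zero, zero_div]
      exact tendsto_const_nhds
    · rw [hDpos N hN]
      exact (hRI N hN).2
  obtain ⟨S, hS⟩ := hR ω₂ lam β γ hω hl hβ hγ μ₀ hμ₀ T hT D hD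
  refine ⟨2 * max S 0 / γ, 2, fun N hN => ?_⟩
  rw [← Real.sqrt_eq_rpow]
  exact escapeFloor_half_of_response_le_sqrt (E := fun N => escapeDeficit ω₂ lam β γ T N) hγ hDpos hS N hN

/-- **`HalfOhmicFloor ⟹ SqrtResponse`.**  Along ANY steady-state family with response coefficients `D`, uniqueness of limits in `𝓝[≠] 0`
and the proved response identity give `D_N = (N−1)γE_N` (`N ≥ 1`); then `response_le_sqrt_of_escapeFloor_half`. [folklore] -/
theorem sqrtResponse_of_halfOhmicFloor : HalfOhmicFloor → SqrtResponse := by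
  intro hF ω₂ lam β γ hω hl hβ hγ μ hμ T hT D hD
  have huniq := bondHeatUncertainty_nessUnique_holds ω₂ lam β γ hω hl hβ hγ
  have hRI := boundaryEscapeDeficit_responseIdentity_holds ω₂ lam β γ hω hl hβ hγ huniq μ hμ T hT
  dsimp only at hRI
  have hDpos : ∀ N : ℕ, 0 < N → D N = ((N : ℝ) - 1) * γ * escapeDeficit ω₂ lam β γ T N := fun N hN =>
    tendsto_nhds_unique (hD N) (hRI N hN).2
  obtain ⟨C, N₀, hfl⟩ := hF ω₂ lam β γ hω hl hβ hγ T hT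
  have hfl' : ∀ N : ℕ, N₀ ≤ N → escapeDeficit ω₂ lam β γ T N ≤ C / Real.sqrt N := fun N hN => by
    rw [Real.sqrt_eq_rpow]; exact hfl N hN
  exact response_le_sqrt_of_escapeFloor_half (E := fun N => escapeDeficit ω₂ lam β γ T N) hγ hDpos hfl'

/-- **`R(1/2) ⟺ F(1/2)`.** [folklore] -/
theorem sqrtResponse_iff_halfOhmicFloor : SqrtResponse ↔ HalfOhmicFloor :=
  ⟨halfOhmicFloor_of_sqrtResponse, sqrtResponse_of_halfOhmicFloor⟩

/-! ## Placement on the ladder -/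

/-- 11071 gives `R(1/2)` (via `F(1) ⟹ F(1/2)`). [folklore] -/
theorem sqrtResponse_of_boundedResponse : BoundedResponse → SqrtResponse := fun h =>
  sqrtResponse_of_halfOhmicFloor (exponentFloor_of_boundedResponse (by norm_num) h)

/-- **Defect law + `R(1/2)` ⟹ 11071**: `SplitLaw θ` (`θ < 1/2`; in particular the constant-defect law `SplitLaw 0`) and `SqrtResponse` give
`BoundedResponse` — `boundedResponse_of_splitLaw_of_exponentFloor` at `s = 1/2`, the floor supplied in response currency. [kernel · frame] -/
theorem boundedResponse_of_splitLaw_of_sqrtResponse {θ : ℝ} (hθ : θ < 1 / 2)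
    (hS : JunctionDefectGrading.SplitLaw θ) (hR : SqrtResponse) : BoundedResponse :=
  JunctionDefectGrading.boundedResponse_of_splitLaw_of_exponentFloor hθ (by norm_num) (by norm_num) hS
    (halfOhmicFloor_of_sqrtResponse hR)

/-- `R(1/2)` + the half-bootstrap ⟹ 11071. [kernel · frame] -/
theorem boundedResponse_of_sqrtResponse_of_bootstrap (hR : SqrtResponse) (hB : ExponentBootstrap (1 / 2 : ℝ)) :
    BoundedResponse :=
  boundedResponse_of_floor_bootstrap (1 / 2 : ℝ) (halfOhmicFloor_of_sqrtResponse hR) hB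

/-- **Buffered junction law + `R(1/2)` ⟹ 11071** (`BufferedJunctionLaw → SplitLaw 0`, file (5)). [kernel · frame] -/
theorem boundedResponse_of_bufferedJunctionLaw_of_sqrtResponse (hB : JunctionDefectGrading.BufferedJunctionLaw)
    (hR : SqrtResponse) : BoundedResponse :=
  boundedResponse_of_splitLaw_of_sqrtResponse (by norm_num) (JunctionDefectGrading.splitLaw_zero_of_bufferedJunctionLaw hB) hR

/-- **NODE instance: `LocalityPassivityLaw ∧ R(1/2) ⟹ 11071`** — junction locality + buffer passivity (file (5), `splitLaw_zero_of_locality_of_passivity`)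
and the half-Ohmic rung in response currency. [kernel · frame] -/
theorem boundedResponse_of_localityPassivityLaw_of_sqrtResponse (hL : JunctionDefectGrading.LocalityPassivityLaw)
    (hR : SqrtResponse) : BoundedResponse :=
  boundedResponse_of_splitLaw_of_sqrtResponse (by norm_num) (JunctionDefectGrading.splitLaw_zero_of_locality_of_passivity hL) hR

end EscapeGrading

end Summit.AtomisticToContinuum.FouriersLaw.Theorems.SubdiffusiveBondHeat

end
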